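import Literature.Computability.AlgebraicComplexity.BooleanGadgets
import HarnessLib

/-!
# Valiant's criterion for `P/poly` coefficient functions

The library form of Valiant's criterion (Valiant 1979; Bürgisser 2000, Prop. 2.20, case of a
`0/1`-valued coefficient function in `P/poly`): if the Boolean functions
`φ_n : {0,1}^{m(n)} → {0,1}` are computed by `B₂`-circuits `Q_n` of polynomially bounded size,
with `m` polynomially bounded, then the family of multilinear polynomials

  `F_n(X_1, …, X_{m(n)}) = ∑_{e ∈ {0,1}^{m(n)}} φ_n(e) · X^e`

is in `VNP` over every commutative ring (`isVNPFamily_circuitSum`). The `VP` witness is the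
transcript arithmetization `arith Q_n` of `CircuitArithmetization.lean` with its input
variables moved into the Boolean block, times the monomial selector `selProd`
(`BooleanGadgets.lean`); its Boolean sum is computed by `sum_eval_arith`.

## References

* L. G. Valiant, *Completeness classes in algebra*, STOC 1979, §4.
* P. Bürgisser, *Completeness and Reduction in Algebraic Complexity Theory*, Springer 2000,
  Prop. 2.20 and its proof.
-/

noncomputable section

open MvPolynomial

universe u

namespace Literature.Computability.AlgebraicComplexity

open Complexity CircuitArith BoolGadgets

namespace ValiantCriterion

variable {k : Type u} [CommRing k]

/-- The multilinear polynomial with `0/1` coefficient function computed by the circuit `Q`: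
`∑_{e ∈ {0,1}^m} [Q(e)] · ∏_{t : e_t = 1} X_t`. [cite: Burgisser2000, Prop. 2.20] -/
def circuitSum {m : ℕ} (Q : Circuit (Fin m)) : MvPolynomial (Fin m) k :=
  ∑ e : Fin m → Bool, C (toK k (Q.eval e)) * ∏ t : Fin m, (if e t then X t else 1)

/-- The relocation of the variables of `arith Q`: inputs and gate variables both go to the
Boolean block `Fin (m + |Q|)`. [cite: Burgisser2000, proof of Prop. 2.20] -/
def reloc {m : ℕ} (Q : Circuit (Fin m)) : Fin m ⊕ Fin Q.size → Fin m ⊕ Fin (m + Q.size) :=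
  fun v => Sum.inr (finSumFinEquiv v)

/-- **The `VP` witness**: `arith Q` on the Boolean block times the selector
`∏_t (e_t X_t + 1 - e_t)`. [cite: Burgisser2000, proof of Prop. 2.20] -/
def witness {m : ℕ} (Q : Circuit (Fin m)) : MvPolynomial (Fin m ⊕ Fin (m + Q.size)) k :=
  rename (reloc Q) (arith Q) *
    selProd (fun t : Fin m => X (Sum.inr (Fin.castAdd Q.size t))) (fun t => X (Sum.inl t))

/-- Splitting an assignment of the Boolean block into inputs and transcript. [folklore] -/
def splitC {m s : ℕ} (c : Fin (m + s) → Bool) : (Fin m → Bool) × (Fin s → Bool) :=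
  (fun i => c (Fin.castAdd s i), fun j => c (Fin.natAdd m j))

/-- **The Boolean sum of the witness is `circuitSum Q`.** [cite: Burgisser2000, Prop. 2.20] -/
theorem boolSum_witness {m : ℕ} (Q : Circuit (Fin m)) (hQ : Q.IsOver B2) :
    boolSum (witness (k := k) Q) = circuitSum Q := by
  classical
  unfold boolSum witness circuitSum
  -- the summand at a Boolean assignment `c = (e, y)`
  have hterm : ∀ c : Fin (m + Q.size) → Bool,
      aeval (Sum.elim X fun j => if c j then (1 : MvPolynomial (Fin m) k) else 0)
        (rename (reloc Q) (arith (k := k) Q) *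
          selProd (fun t : Fin m => X (Sum.inr (Fin.castAdd Q.size t))) (fun t => X (Sum.inl t))) =
      C (eval (bpt k (splitC c).1 (splitC c).2) (arith Q)) * ∏ t : Fin m, (if (splitC c).1 t then X t else 1) := by
    intro c
    rw [map_mul]
    congr 1
    · rw [aeval_rename]
      have hφ : ((Sum.elim X fun j => if c j then (1 : MvPolynomial (Fin m) k) else 0) ∘ reloc Q) =
          fun v => C (bpt k (splitC c).1 (splitC c).2 v) := by
        funext v
        cases v with
        | inl i =>
          simp only [Function.comp_apply, reloc, finSumFinEquiv_apply_left, Sum.elim_inr, bpt, splitC, Sum.elim_inl]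
          cases c (Fin.castAdd Q.size i) <;> simp [toK]
        | inr j =>
          simp only [Function.comp_apply, reloc, finSumFinEquiv_apply_right, Sum.elim_inr, bpt, splitC]
          cases c (Fin.natAdd m j) <;> simp [toK]
      rw [hφ]
      exact aeval_C_comp _ _
    · rw [aeval_selProd _ _ _ (splitC c).1]
      · refine Finset.prod_congr rfl fun t _ => ?_
        rw [aeval_X]; rfl
      · intro t
        simp only [aeval_X, Sum.elim_inr, splitC, MvPolynomial.algebraMap_eq]
        cases c (Fin.castAdd Q.size t) <;> simp [toK]
  simp only [hterm]
  -- sum over `c` = sum over `(e, y)`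
  have hsplit : ∀ F : (Fin m → Bool) → (Fin Q.size → Bool) → MvPolynomial (Fin m) k,
      ∑ c : Fin (m + Q.size) → Bool, F (splitC c).1 (splitC c).2 = ∑ e : Fin m → Bool, ∑ y : Fin Q.size → Bool, F e y := by
    intro F
    rw [← Fintype.sum_prod_type']
    refine Fintype.sum_equiv ((Equiv.sumArrowEquivProdArrow _ _ _).symm.trans
      (Equiv.arrowCongr finSumFinEquiv (Equiv.refl Bool))).symm _ _ fun c => ?_
    congr
  rw [hsplit fun e y => C (eval (bpt k e y) (arith Q)) * ∏ t : Fin m, (if e t then X t else 1)]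
  refine Finset.sum_congr rfl fun e _ => ?_
  rw [← Finset.sum_mul, ← map_sum, sum_eval_arith Q hQ e]

/-- The witness has `L ≤ 60 |Q| + 5m + 2`. [cite: Burgisser2000, Prop. 2.20 (g ∈ VP)] -/
theorem complexity_witness_le {m : ℕ} (Q : Circuit (Fin m)) :
    complexity (witness (k := k) Q) ≤ 60 * Q.size + 5 * m + 2 := by
  unfold witness
  have h1 := (complexity_rename_le_holds' (k := k) (reloc Q) (arith (k := k) Q)).trans (complexity_arith_le Q)
  have h2 : complexity (selProd (fun t : Fin m => (X (Sum.inr (Fin.castAdd Q.size t)) : MvPolynomial (Fin m ⊕ Fin (m + Q.size)) k))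
      (fun t => X (Sum.inl t))) ≤ 5 * m := by
    refine (complexity_selProd_le _ _).trans (le_of_eq ?_)
    rw [Finset.sum_eq_zero fun t _ => by rw [complexity_X_holds, complexity_X_holds]; rfl, zero_add]
  have h3 := complexity_mul_le_holds (rename (reloc Q) (arith (k := k) Q))
    (selProd (fun t : Fin m => X (Sum.inr (Fin.castAdd Q.size t))) (fun t => X (Sum.inl t)))
  omega

/-- The witness has degree `≤ 3 |Q| + 1 + 2m`. [folklore] -/
theorem totalDegree_witness_le {m : ℕ} (Q : Circuit (Fin m)) :
    (witness (k := k) Q).totalDegree ≤ 3 * Q.size + 1 + 2 * m := by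
  unfold witness
  refine (totalDegree_mul _ _).trans (Nat.add_le_add ((totalDegree_rename_le _ _).trans (totalDegree_arith_le Q)) ?_)
  refine (totalDegree_selProd_le _ _).trans ?_
  calc ∑ t : Fin m, ((X (Sum.inr (Fin.castAdd Q.size t)) : MvPolynomial (Fin m ⊕ Fin (m + Q.size)) k).totalDegree +
        (X (Sum.inl t) : MvPolynomial (Fin m ⊕ Fin (m + Q.size)) k).totalDegree)
      ≤ ∑ _t : Fin m, 2 := Finset.sum_le_sum fun t _ =>
        Nat.add_le_add (totalDegree_X_le_one' (k := k) _) (totalDegree_X_le_one' (k := k) _)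
    _ = 2 * m := by simp [mul_comm]

/-- `circuitSum Q` has degree `≤ m`. [folklore] -/
theorem totalDegree_circuitSum_le {m : ℕ} (Q : Circuit (Fin m)) : (circuitSum (k := k) Q).totalDegree ≤ m := by
  unfold circuitSum
  refine (totalDegree_finsetSum _ _).trans (Finset.sup_le fun e _ => ?_)
  refine (totalDegree_mul _ _).trans ?_
  rw [totalDegree_C, zero_add]
  refine (totalDegree_finsetProd _ _).trans ?_
  calc ∑ t : Fin m, (if e t then (X t : MvPolynomial (Fin m) k) else 1).totalDegree ≤ ∑ _t : Fin m, 1 :=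
        Finset.sum_le_sum fun t _ => by
          split_ifs
          · exact totalDegree_X_le_one' (k := k) _
          · rw [totalDegree_one]; exact Nat.zero_le _
    _ = m := by simp

end ValiantCriterion

open ValiantCriterion

/-- **Valiant's criterion** (Valiant 1979; Bürgisser 2000, Prop. 2.20, for `0/1` coefficient
functions in `P/poly`): if `m` is p-bounded and the Boolean functions computed by the
`B₂`-circuits `Q_n` on `m(n)` inputs have p-bounded size, then
`(∑_{e ∈ {0,1}^{m(n)}} [Q_n(e)] X^e)_n ∈ VNP` over every commutative ring. [cite: Burgisser2000, Prop. 2.20] -/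
theorem isVNPFamily_circuitSum {k : Type u} [CommRing k] {m : ℕ → ℕ} (hm : IsPBounded m)
    (Q : ∀ n, Circuit (Fin (m n))) (hQ : ∀ n, (Q n).IsOver B2) (hs : IsPBounded fun n => (Q n).size) :
    IsVNPFamily (σ := fun n => Fin (m n)) (fun n => circuitSum (k := k) (Q n)) := by
  refine ⟨⟨by simpa using hm, hm.mono fun n => totalDegree_circuitSum_le (Q n)⟩,
    fun n => m n + (Q n).size, fun n => witness (Q n), ⟨⟨?_, ?_⟩, ?_⟩, fun n => (boolSum_witness (Q n) (hQ n)).symm⟩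
  · have h : (fun n => Fintype.card (Fin (m n) ⊕ Fin (m n + (Q n).size))) = fun n => m n + (m n + (Q n).size) := by
      funext n; simp
    rw [h]
    exact IsPBounded.add_holds hm (IsPBounded.add_holds hm hs)
  · refine (IsPBounded.add_holds (IsPBounded.add_holds (IsPBounded.mul_holds (IsPBounded.const 3) hs)
      (IsPBounded.const 1)) (IsPBounded.mul_holds (IsPBounded.const 2) hm)).mono fun n => ?_
    exact totalDegree_witness_le (Q n)
  · refine (IsPBounded.add_holds (IsPBounded.add_holds (IsPBounded.mul_holds (IsPBounded.const 60) hs)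
      (IsPBounded.mul_holds (IsPBounded.const 5) hm)) (IsPBounded.const 2)).mono fun n => ?_
    exact complexity_witness_le (Q n)

end Literature.Computability.AlgebraicComplexity
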